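import Summits.HodgeConjecture.HodgeConjecture.Theorems.MarkmanPartnerTransportPicardThreeK3SquaresOneCycle

/-!
# Route MarkmanPartnerTransport · crux `PicardThreeK3Squares` (stmt-HodgeConjecture-19652) —
# lemmas for the real-QUADRATIC GENERATOR: the quadratic relation in a degree-`2` endomorphism field,
# the rational-point count of `N¹`, and the CM witness of a non-real embedding

Support lemmas (prover seat hodge-nonav-19652-p1, gen 9) for `…PicardThreeK3SquaresQuadraticRelation` /
`…QuadraticGenerator`, which produce the real-quadratic generator `QuadGen[S]` of
`…KugaSatakeQuadraticThird` from arithmetic (`22 − ρ(S) ∈ {6, 8, 10, 14}`, not CM, not scalar):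

* `two_smul_sub_smul_identity` — the module identity behind `ψ² = a² + 4b`.
* `exists_quadratic_relation_of_totallyReal` (abstract carriers) — for `H` irreducible of K3 type,
  polarized, `E = End_Hdg(V)` a totally real field with `dim V = d · m`, `d ≥ 2`, `m ≥ 3` forcing `d = 2`:
  a non-scalar `r ∈ E` satisfies `r² = a r + b` with `b ≠ 0`, `a² + 4b ≠ 0` (van Geemen's `m ≥ 3` gives
  `[E:ℚ] = 2`; minimal polynomial).
* `finrank_ratPoints_eq` — marking picture: the rational points `N_ℚ ≤ Λ_ℚ` of `N¹(S)` have
  `dim_ℚ N_ℚ = dim_ℂ N¹(S)` (the gen-8 engine's count, as a lemma).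
* `hasComplexMultiplication_of_conj_ne` — marking picture: an element of `End_Hdg(T)` with a NON-REAL
  value under some embedding makes `S` CM (Zarhin's adjoint theorem; the gen-8 engine's CM branch, as a lemma).

No definition, no sorry, no named fact. `--supports stmt-HodgeConjecture-19652`. Nothing here proves HC.

References: Yu. G. Zarhin, J. reine angew. Math. 341 (1983) Thm. 1.5.1, 1.6; B. van Geemen, Michigan Math. J. 56
(2008) Lemma 3.2; D. Huybrechts, *Lectures on K3 Surfaces*, Ch. 3 Thm. 3.3.7, Lemma 3.3.12, Ch. 1 Prop. 3.5.
-/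

set_option linter.dupNamespace false

noncomputable section

namespace Summit.HodgeConjecture.HodgeConjecture.Theorems.MarkmanPartnerTransport.KugaSatakeSimilitude

open scoped Manifold TensorProduct
open Module CategoryTheory MonoidalCategory CartesianMonoidalCategory Polynomial
open Literature.AlgebraicGeometry Literature.AlgebraicGeometry.Motives Literature.AlgebraicGeometry.HodgeTheory
open Literature.AlgebraicGeometry.Motives.HodgeStructure
open Literature.AlgebraicGeometry.Surfaces
open Literature.AlgebraicTopology.SingularHomology
open Summit.HodgeConjecture.HodgeConjecture.Theorems
open Summit.HodgeConjecture.HodgeConjecture.Theorems.NikulinTwinTransport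
open Summit.HodgeConjecture.HodgeConjecture.Theorems.AnchorExistenceCMFloor
open Summit.HodgeConjecture.HodgeConjecture.Theorems.MarkmanPartnerTransport.RealMultiplicationRanks
open Summit.HodgeConjecture.HodgeConjecture.Theorems.MarkmanPartnerTransport.OneCycle

variable {S : SchemeOver ℂ}

/-- The module identity behind `ψ² = a² + 4b`: with `u = f y`, `f u = a u + b y` and `ψ = 2f − a`,
`ψ(ψ y) = 2(2(a u + b y) − a u) − a(2u − a y) = (a² + 4b) y`. [folklore] -/
theorem two_smul_sub_smul_identity {M : Type*} [AddCommGroup M] [Module ℂ M] (a b : ℂ) (u y : M) :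
    (2 : ℂ) • ((2 : ℂ) • (a • u + b • y) - a • u) - a • ((2 : ℂ) • u - a • y) = (a * a + 4 * b) • y := by
  module

/-! ### Abstract carriers: a non-scalar element of a real-quadratic `End_Hdg` satisfies `r² = a r + b` -/

section Abstract

universe u

variable {V : Type u} [AddCommGroup V] [Module ℚ V] [Module.Finite ℚ V] {H : HodgeStructure V 2}

/-- **The quadratic relation.** For `H` irreducible of K3 type, polarized, with `E = End_Hdg(V)` a totally
real field and `dim_ℚ V = d · m`, `d ≥ 2`, `m ≥ 3` forcing `d = 2`: `[E : ℚ] = 2` (van Geemen's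
`dim V = [E:ℚ] · m`, `m ≥ 3`, and `E ≠ ℚ`), so a non-scalar `r ∈ E` has a monic quadratic minimal
polynomial `X² − aX − b` with `b ≠ 0` (irreducibility) and discriminant `a² + 4b ≠ 0` (else
`r = a/2 ∈ ℚ`). [cite: Vangeemen2008, Lemma 3.2] [cite: Zarhin1983HodgeGroupsK3, Thm. 1.5.1] -/
theorem exists_quadratic_relation_of_totallyReal (hirr : H.IsIrreducible) (hK3 : H.IsOfK3Type)
    (ψ : H.Polarization) (hF : IsField H.endAlg)
    (hreal : ∀ (φ : H.endAlg →+* ℂ) (a : H.endAlg), starRingEnd ℂ (φ a) = φ a)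
    (hV : ∀ d m : ℕ, 2 ≤ d → 3 ≤ m → Module.finrank ℚ V = d * m → d = 2)
    {r : H.endAlg} (hr : r ∉ (⊥ : Subalgebra ℚ H.endAlg)) :
    ∃ a b : ℚ, b ≠ 0 ∧ a * a + 4 * b ≠ 0 ∧ r * r = a • r + algebraMap ℚ H.endAlg b := by
  classical
  haveI := isDomain_endAlg_of_isField hF
  haveI : Module.Finite ℚ H.endAlg := finiteDimensional_endAlg H
  haveI : Nontrivial V := hirr.nontrivial
  haveI : CharZero H.endAlg := charZero_of_injective_algebraMap (algebraMap ℚ H.endAlg).injective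
  obtain ⟨m, hm, hdim⟩ := exists_three_le_finrank_eq_mul hirr hK3 ψ hF hreal
  have h1 := one_le_finrank_endAlg H
  have hne1 : Module.finrank ℚ H.endAlg ≠ 1 := fun h1' =>
    hr (by rw [Subalgebra.bot_eq_top_of_finrank_eq_one h1']; exact Algebra.mem_top)
  have hE2 : Module.finrank ℚ H.endAlg = 2 := hV _ m (by omega) hm hdim
  set A := algebraMap ℚ H.endAlg with hA
  have hmem : ∀ q : ℚ, A q ∈ (⊥ : Subalgebra ℚ H.endAlg) := fun q => Algebra.mem_bot.2 ⟨q, rfl⟩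
  -- the minimal polynomial of `r` is monic of degree `2`
  have hint : IsIntegral ℚ r := .of_finite ℚ r
  have hmonic : (minpoly ℚ r).Monic := minpoly.monic hint
  have hdeg : (minpoly ℚ r).natDegree = 2 := by
    have hle : (minpoly ℚ r).natDegree ≤ 2 := hE2 ▸ minpoly.natDegree_le r
    have hpos : 0 < (minpoly ℚ r).natDegree := minpoly.natDegree_pos hint
    have hne : (minpoly ℚ r).natDegree ≠ 1 := by
      intro h1'
      apply hr
      have hdeg1 : (minpoly ℚ r).degree = 1 := by
        rw [Polynomial.degree_eq_natDegree hmonic.ne_zero, h1']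
        rfl
      obtain ⟨q, hq⟩ := minpoly.mem_range_of_degree_eq_one ℚ r hdeg1
      rw [Algebra.mem_bot]
      exact ⟨q, hq⟩
    omega
  have h2 : (minpoly ℚ r).coeff 2 = 1 := by rw [← hdeg]; exact hmonic.coeff_natDegree
  -- `c₀ + c₁ r + r² = 0`
  set c₀ : ℚ := (minpoly ℚ r).coeff 0 with hc₀
  set c₁ : ℚ := (minpoly ℚ r).coeff 1 with hc₁
  have haev : A c₀ + A c₁ * r + r * r = 0 := by
    have h := minpoly.aeval ℚ r
    rw [Polynomial.aeval_eq_sum_range, hdeg] at h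
    simp only [Finset.sum_range_succ, Finset.sum_range_zero, zero_add, pow_zero, pow_one, h2,
      Algebra.smul_def, mul_one, map_one, one_mul] at h
    rw [pow_two] at h
    exact h
  refine ⟨-c₁, -c₀, ?_, ?_, ?_⟩
  · -- `b ≠ 0`: else `r (A c₁ + r) = 0`, so `r ∈ ℚ`
    intro hb
    rw [neg_eq_zero] at hb
    rw [hb, map_zero, zero_add] at haev
    have hmul : r * (A c₁ + r) = 0 := by rw [mul_add, ← Algebra.commutes c₁ r]; exact haev
    rcases mul_eq_zero.1 hmul with h0 | h0
    · exact hr (h0 ▸ Subalgebra.zero_mem _)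
    · apply hr
      have hr' : r = A (-c₁) := by rw [map_neg]; exact (neg_eq_of_add_eq_zero_right h0).symm
      rw [hr']
      exact hmem _
  · -- discriminant: else `(2r + c₁)² = 0`, so `r = -c₁/2 ∈ ℚ`
    intro hd
    have hcomm : A c₁ * r = r * A c₁ := Algebra.commutes c₁ r
    have hsq : (r + r + A c₁) * (r + r + A c₁) = A ((-c₁) * (-c₁) + 4 * (-c₀)) := by
      have e : (r + r + A c₁) * (r + r + A c₁) =
          4 * (A c₀ + A c₁ * r + r * r) + (A c₁ * A c₁ - 4 * A c₀) + 2 * (r * A c₁ - A c₁ * r) := by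
        noncomm_ring
      rw [e, haev, hcomm, sub_self, mul_zero, mul_zero, zero_add, add_zero,
        show (-c₁) * (-c₁) + 4 * (-c₀) = c₁ * c₁ - 4 * c₀ by ring, map_sub, map_mul, map_mul, map_ofNat]
    rw [hd, map_zero] at hsq
    have hs0 : r + r + A c₁ = 0 := by
      rcases mul_eq_zero.1 hsq with h0 | h0 <;> exact h0
    apply hr
    have h2r : (2 : H.endAlg) * r = 2 * A (-c₁ / 2) := by
      rw [← map_ofNat A 2, ← map_mul, show (2 : ℚ) * (-c₁ / 2) = -c₁ by ring, map_neg, map_ofNat, two_mul]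
      exact eq_neg_of_add_eq_zero_left hs0
    have hr' : r = A (-c₁ / 2) := mul_left_cancel₀ two_ne_zero h2r
    rw [hr']
    exact hmem _
  · rw [map_neg, neg_smul, Algebra.smul_def, eq_neg_of_add_eq_zero_right haev, neg_add, add_comm]

end Abstract

/-! ### Marking picture: `dim_ℚ N_ℚ = dim_ℂ N¹(S)` -/

/-- **The rational points of `N¹(S)` read through a marking have `ℚ`-dimension `dim_ℂ N¹(S)`**: `N¹` is
spanned over `ℂ` by its rational classes (`supportedClasses_eq_span`), and a `ℚ`-basis of `N_ℚ` is
`ℂ`-independent (`ι_{N_ℚ} : ℂ ⊗_ℚ N_ℚ ↪ Λ_ℂ`). The gen-8 engine's inline count, as a lemma.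
[cite: Huybrechts2016K3, Ch. 1 Prop. 3.5 and Ch. 3 Lemma 3.3.1] [cite: VoisinHodgeI2002, Thm. 11.30] -/
theorem finrank_ratPoints_eq (hS : IsK3Surface S) (η : complexBetti S (2 * 1) ≃ₗ[ℂ] (K3Index → ℂ))
    (hηint : ∀ c : complexBetti S (2 * 1), IsIntegralClass c ↔ ∃ v : K3Index → ℤ, η c = fun i => (v i : ℂ))
    (NQ : Submodule ℚ (K3Index → ℚ))
    (memNQ : ∀ u, u ∈ NQ ↔ η.symm (fun j => (u j : ℂ)) ∈ algebraicClasses S 1) :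
    Module.finrank ℚ ↥NQ = Module.finrank ℂ ↥(algebraicClasses S 1) := by
  classical
  set N := algebraicClasses S 1 with hNdef
  have hrat : ∀ c, IsRationalClass c ↔ ∃ w : K3Index → ℚ, η c = fun i => (w i : ℂ) :=
    isRationalClass_iff_of_marking hS η hηint
  have hspan := span_isRationalClass_eq_top_of_isSmoothProjective_holds.supportedClasses_eq_span
    hS.1 (2 * 1) 1
  let b := Module.finBasis ℚ NQ
  let c : Fin (Module.finrank ℚ ↥NQ) → complexBetti S (2 * 1) :=
    fun i => η.symm (fun j => (((b i : NQ) : K3Index → ℚ) j : ℂ))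
  have hcN : ∀ i, c i ∈ N := fun i => (memNQ _).1 (b i).2
  have hle : N ≤ Submodule.span ℂ (Set.range c) := by
    intro d hd
    have hd' : d ∈ Submodule.span ℂ {c : complexBetti S (2 * 1) |
        IsRationalClass c ∧ c ∈ supportedClasses S (2 * 1) 1} := by
      rw [← hspan]; exact hd
    refine Submodule.span_le.2 ?_ hd'
    rintro d ⟨hdQ, hdN⟩
    obtain ⟨w, hw⟩ := (hrat d).1 hdQ
    have hwN : w ∈ NQ := by
      rw [memNQ, ← hw, LinearEquiv.symm_apply_apply]
      exact hdN
    have hd_eq : d = η.symm (fun j => (w j : ℂ)) := by rw [← hw, LinearEquiv.symm_apply_apply]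
    have hw_eq : (w : K3Index → ℚ) = ∑ i, (b.repr ⟨w, hwN⟩ i) • ((b i : NQ) : K3Index → ℚ) := by
      have h := congrArg (fun t : NQ => (t : K3Index → ℚ)) (b.sum_repr ⟨w, hwN⟩).symm
      simpa only [Submodule.coe_sum, Submodule.coe_smul] using h
    rw [SetLike.mem_coe, hd_eq, hw_eq, ratCastΛ_sum, map_sum]
    refine Submodule.sum_mem _ fun i _ => ?_
    rw [ratCastΛ_smul, map_smul]
    exact Submodule.smul_mem _ _ (Submodule.subset_span ⟨i, rfl⟩)
  haveI : Module.Finite ℂ ↥(Submodule.span ℂ (Set.range c)) :=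
    Module.Finite.span_of_finite ℂ (Set.finite_range c)
  haveI : Module.Finite ℂ ↥N := Submodule.finiteDimensional_of_le hle
  have hdimN_le : Module.finrank ℂ ↥N ≤ Module.finrank ℚ ↥NQ :=
    (Submodule.finrank_mono hle).trans ((finrank_range_le_card c).trans (by simp))
  have hcind : LinearIndependent ℂ c := by
    rw [Fintype.linearIndependent_iff]
    intro z hz i
    have hB := (Algebra.TensorProduct.basis ℂ b).linearIndependent
    rw [Fintype.linearIndependent_iff] at hB
    refine hB z ?_ i
    apply iota_injective NQ
    rw [map_sum, map_zero]
    have h := congrArg η hz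
    rw [map_sum, map_zero] at h
    refine (Finset.sum_congr rfl fun j _ => ?_).trans h
    rw [map_smul, Algebra.TensorProduct.basis_apply, iota_one_tmul, map_smul, LinearEquiv.apply_symm_apply]
  have hdimN_ge : Module.finrank ℚ ↥NQ ≤ Module.finrank ℂ ↥N := by
    let c' : Fin (Module.finrank ℚ ↥NQ) → ↥N := fun i => ⟨c i, hcN i⟩
    have hcomp : ⇑N.subtype ∘ c' = c := funext fun i => rfl
    have hc' : LinearIndependent ℂ c' := LinearIndependent.of_comp N.subtype (hcomp ▸ hcind)
    simpa using hc'.fintype_card_le_finrank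
  exact le_antisymm hdimN_ge hdimN_le

/-! ### Marking picture: a non-real embedding value in `End_Hdg(T)` makes `S` CM -/

/-- **CM witness.** In the marking picture (`η`, `p₀`, period `x`, `N_ℚ = Λ_ℚ ∩ {x, x̄}^⊥` with
`N_ℚ ∩ N_ℚ^⊥ = 0`, transcendental Hodge structure `hodgeT`), an element `a ∈ End_Hdg(T)` and a ring
embedding `φ' : End_Hdg(T) → ℂ` with `φ'(a)` NOT real give `HasComplexMultiplication S`: by Zarhin's
adjoint theorem the adjoint `a'` of `a` has `φ'(a') = conj φ'(a) ≠ φ'(a)`, so `a' ≠ a` and the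
`(2,0)`-eigenvalue `ε(a)` is not real (else `ε(a') = conj ε(a) = ε(a)`, `a' = a`); the extension of `a`
by the identity of `N_ℚ`, conjugated by the marking, is a rational, type-preserving endomorphism of
`H²(S(ℂ); ℂ)` with that eigenvalue on `σ = η⁻¹x`. The gen-8 engine's CM branch, as a lemma.
[cite: Zarhin1983HodgeGroupsK3, Thm. 1.5.1 and Thm. 1.6] [cite: Huybrechts2016K3, Ch. 3 Thm. 3.3.7 and Lemma 3.3.1] -/
theorem hasComplexMultiplication_of_conj_ne (hS : IsK3Surface S)
    (η : complexBetti S (2 * 1) ≃ₗ[ℂ] (K3Index → ℂ)) (p₀ : complexBetti S (2 * 2)) (hp₀ : p₀ ≠ 0)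
    (hηint : ∀ c : complexBetti S (2 * 1), IsIntegralClass c ↔ ∃ v : K3Index → ℤ, η c = fun i => (v i : ℂ))
    (hηcup : ∀ a b : complexBetti S (2 * 1),
      cupProduct (rfl : 2 * 1 + 2 * 1 = 2 * 2) a b = k3Form (η a) (η b) • p₀)
    (x : K3Index → ℂ) (hx20 : IsOfHodgeType 2 S (2 * 1) 2 0 (η.symm x)) (hxne : η.symm x ≠ 0)
    {NQ : Submodule ℚ (K3Index → ℚ)}
    (hN : ∀ u : K3Index → ℚ, u ∈ NQ ↔
      (k3Form (fun i => (u i : ℂ)) x = 0 ∧ k3Form (fun i => (u i : ℂ)) (star x) = 0))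
    (hdisj : Disjoint NQ (k3FormRat.orthogonal NQ)) (hxx : k3Form x x = 0)
    (hxpos : 0 < (k3Form (star x) x).re)
    (hu : ∃ u : K3Index → ℤ, k3Form (fun i => (u i : ℂ)) x = 0 ∧ 0 < ∑ i, ∑ j, u i * k3Gram i j * u j)
    (a : ↥(hodgeT hN hdisj hxx hxpos).endAlg) (φ' : ↥(hodgeT hN hdisj hxx hxpos).endAlg →+* ℂ)
    (hφ'a : starRingEnd ℂ (φ' a) ≠ φ' a) :
    HasComplexMultiplication S := by
  classical
  have hHT : Huybrechts_K3_hodgeTypes_H2 := Huybrechts_K3_hodgeTypes_H2_holds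
  set σ := η.symm x with hσdef
  have hησ : η σ = x := by rw [hσdef, LinearEquiv.apply_symm_apply]
  obtain ⟨h₁, -, h₃⟩ := hHT S hS σ hx20 hxne
  have hσbar : conjClass (ComplexPoints S) (2 * 1) σ = η.symm (star x) := conjClass_marking_symm η hηint x
  have hsmul0 : ∀ {c : ℂ}, c • p₀ = 0 → c = 0 := fun h => by
    rcases smul_eq_zero.1 h with h | h
    · exact h
    · exact absurd h hp₀
  have hrat : ∀ c, IsRationalClass c ↔ ∃ w : K3Index → ℚ, η c = fun i => (w i : ℂ) :=
    isRationalClass_iff_of_marking hS η hηint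
  have h11_iff : ∀ v : K3Index → ℂ, IsOfHodgeType 2 S (2 * 1) 1 1 (η.symm v) ↔
      (k3Form v x = 0 ∧ k3Form v (star x) = 0) := by
    intro v
    rw [h₃ (η.symm v), hηcup, hηcup, LinearEquiv.apply_symm_apply, hησ, hσbar, LinearEquiv.apply_symm_apply]
    constructor
    · rintro ⟨ha, hb⟩
      exact ⟨hsmul0 ha, hsmul0 hb⟩
    · rintro ⟨ha, hb⟩
      rw [ha, hb, zero_smul]
      exact ⟨rfl, rfl⟩
  have hK3 : (hodgeT hN hdisj hxx hxpos).IsOfK3Type := isOfK3Type_hodgeT hN hdisj hxx hxpos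
  have hirr : (hodgeT hN hdisj hxx hxpos).IsIrreducible := isIrreducible_hodgeT hN hdisj hxx hxpos
  let ψ : (hodgeT hN hdisj hxx hxpos).Polarization := polT hN hdisj hxx hxpos hu
  obtain ⟨-, ε, hεinj, hε⟩ := Zarhin1983_endAlg_isField_holds (hodgeT hN hdisj hxx hxpos) hirr hK3
  have hω : omega x hdisj ∈ (hodgeT hN hdisj hxx hxpos).piece 2 0 :=
    (mem_piece_two_zero_ofPeriod _ _).2 ⟨1, one_smul _ _⟩
  obtain ⟨hadjex, hadjconj⟩ := Zarhin1983_adjoint_eq_conj_holds (hodgeT hN hdisj hxx hxpos) hirr hK3 ψ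
  obtain ⟨a', ha'⟩ := hadjex a
  have hne : a' ≠ a := by
    intro h
    apply hφ'a
    have key := hadjconj a a' ha' φ'
    rw [h] at key
    exact key.symm
  set μ : ℂ := ε a with hμdef
  have hμ : μ.im ≠ 0 := by
    intro him
    apply hne
    apply hεinj
    have key := hadjconj a a' ha' ε.toRingHom
    change ε a' = starRingEnd ℂ (ε a) at key
    rw [key, ← hμdef]
    exact Complex.conj_eq_iff_im.2 him
  have hamem : ((a : (hodgeT hN hdisj hxx hxpos).endAlg) : Module.End ℚ ↥(k3FormRat.orthogonal NQ)) ∈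
      (hodgeT hN hdisj hxx hxpos).endAlg := a.2
  set û : Module.End ℚ (K3Index → ℚ) := extendT hdisj (a : Module.End ℚ ↥(k3FormRat.orthogonal NQ)) with hû
  have hûx : cxEnd û x = μ • x := by
    have h := hε a (omega x hdisj) hω
    have h2 := congrArg (iota (k3FormRat.orthogonal NQ)) h
    rw [iota_baseChange hdisj, iota_omega hN hdisj, map_smul, iota_omega hN hdisj] at h2
    exact h2
  have hû11 : ∀ z : K3Index → ℂ, k3Form z x = 0 → k3Form z (star x) = 0 →
      k3Form (cxEnd û z) x = 0 ∧ k3Form (cxEnd û z) (star x) = 0 :=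
    fun z hzx hzx' => k3Form_cxEnd_extendT hN hdisj hxx hxpos hamem hzx hzx'
  let Ψ : complexBetti S (2 * 1) →ₗ[ℂ] complexBetti S (2 * 1) :=
    η.symm.toLinearMap ∘ₗ cxEnd û ∘ₗ η.toLinearMap
  have hΨapp : ∀ y, Ψ y = η.symm (cxEnd û (η y)) := fun y => rfl
  have hΨrat : ∀ y, IsRationalClass y → IsRationalClass (Ψ y) := by
    intro y hy
    obtain ⟨w, hw⟩ := (hrat y).1 hy
    rw [hΨapp, hw, cxEnd_ratCast]
    exact (hrat _).2 ⟨û w, LinearEquiv.apply_symm_apply _ _⟩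
  have hΨσ : Ψ σ = μ • σ := by rw [hΨapp, hησ, hûx, map_smul]
  have hΨtyp : ∀ (i j : ℕ) y, IsOfHodgeType 2 S (2 * 1) i j y → IsOfHodgeType 2 S (2 * 1) i j (Ψ y) := by
    refine typePreserving_of_lines hHT hS hx20 hxne Ψ ⟨μ, hΨσ⟩ ⟨star μ, ?_⟩ fun v hv => ?_
    · rw [hσbar, hΨapp, LinearEquiv.apply_symm_apply, cxEnd_star, hûx, star_smul, map_smul]
    · have hv' := hv
      rw [← LinearEquiv.symm_apply_apply η v, h11_iff] at hv'
      rw [hΨapp, h11_iff]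
      exact hû11 (η v) hv'.1 hv'.2
  exact ⟨Ψ, hΨrat, hΨtyp, σ, μ, hx20, hxne, hμ, hΨσ⟩

end Summit.HodgeConjecture.HodgeConjecture.Theorems.MarkmanPartnerTransport.KugaSatakeSimilitude

end
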